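import Mathlib

/-!
# LINE LAW — a divisor datum is proper: `N z · (Im w)² + N w · (Im z)² + 2A · Im z · Im w = 1` (ENGINE-W code B, #B16)

On a weight line reached at winding `T` with residue `A` (THEOREM CF⁶ of the LINE LAW, card LINE-LAW-B.md;
consolidated text LINE-LAW-THEOREMS-B.md), every weight `c` comes with a divisor datum `z · w = A − √m` in `ℤ√m`,
`N z = T / c`.  LEMMA P of the consolidated text (REF-W ROW 359, rider P-NSQ-1) starts from the step
(∗) «the principal ideal `(z) = (N z, −A + √m)` is invertible, so the form `(N z, 2A, N w)` is primitive», so far a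
hand step; kernel #B15 (`LineLawProperness`) takes it as the hypothesis `hprim`.  This file makes (∗) kernel by ONE
ring identity: writing `z = x + y√m`, `w = u + v√m`, the `√m`-coordinate of `z w = A − √m` is `x v + y u = −1`, and
`N z · v² + N w · y² + 2A · y v = (x v + y u)² = 1`.
Hence no integer other than `±1` divides `N z`, `N w` and `2A` (`isUnit_of_dvd`, `gcd_norm_norm_two_mul_eq_one`),
the #B15 hypothesis `hprim` holds for every datum (`form_primitive`), and LEMMA P (ii) — no prime divides `T / c`, `c`
and `2A` — follows for every datum with `T ∣ A² − m` WITHOUT any primitivity hypothesis (`gcd_hypothesis_of_datum`),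
which is exactly the input of the one-sided bookkeeping `LineLawIdealProduct.primIdeal_mul_of_gcd` (#B14) in
THEOREM E «⇒».  The other two clauses of LEMMA P are made kernel for every datum as well: (i) `T ∣ A² − m` as soon
as the weights of the line have no common divisor (`winding_dvd_of_bezout`: `cᵢ · (A² − m) = T · N wᵢ` for every
weight, times a Bézout combination `∑ aᵢ cᵢ = 1`), and (iii) the weight ideals `𝔞_c(A) = (c, −A + √m)` are PROPER —
the forms `(c, 2A, (A² − m)∕c)` are primitive (`weightForm_primitive_at`, `weightForm_primitive_of_bezout`: a prime
`q ∣ c` meets a weight `c'` prime to `q`, and the common cofactor `e = (A² − m)∕T` transfers the question to the datum of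
`c'`).  So THEOREM E's «one class» is a statement about proper ideals, i.e. in the form class group of discriminant
`4m`.  No squarefree or sign hypothesis on `m` anywhere.
Honest framing: ring arithmetic in `ℤ√m` only; Mukai vectors and lattices elsewhere, not objects; nothing here says
that HC, HC_CM or HC_AV holds.
-/

namespace Summit.Ventures.HSemireg.LineLawPrincipalProper

open Zsqrtd

/-- The coordinates of a divisor datum `z · w = A − √m`: `Re z · Re w + m · Im z · Im w = A` and
`Re z · Im w + Im z · Re w = −1`. -/
theorem coords_of_datum {m A : ℤ} {z w : ℤ√m} (h : z * w = ⟨A, -1⟩) :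
    z.re * w.re + m * z.im * w.im = A ∧ z.re * w.im + z.im * w.re = -1 :=
  ⟨by simpa [Zsqrtd.re_mul] using congrArg Zsqrtd.re h,
   by simpa [Zsqrtd.im_mul] using congrArg Zsqrtd.im h⟩

/-- On a datum with `T = c · N z` and `T ∣ A² − m`, the weight divides the co-norm: `c ∣ N w`
(from `N z · N w = A² − m`, which is `LineLawRamifiedCapture.norm_mul_norm_of_dvd`, re-derived in the proof). -/
theorem weight_dvd_conorm {m A T c : ℤ} {z w : ℤ√m} (h : z * w = ⟨A, -1⟩) (hT : T = c * z.norm)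
    (hdiv : T ∣ A * A - m) (hn : z.norm ≠ 0) : c ∣ w.norm := by
  have hmul : z.norm * w.norm = A * A - m := by
    have e : (z * w).norm = A * A - m * (-1) * (-1) := by rw [h, Zsqrtd.norm_def]
    rw [Zsqrtd.norm_mul] at e
    linear_combination e
  have : z.norm * c ∣ z.norm * w.norm := by rw [hmul, mul_comm, ← hT]; exact hdiv
  exact (mul_dvd_mul_iff_left hn).1 this

/-- **The properness identity.** If `z · w = A − √m` in `ℤ√m` then
`N z · (Im w)² + N w · (Im z)² + 2A · (Im z · Im w) = 1` — it is `(Re z · Im w + Im z · Re w)² = (−1)²`. -/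
theorem norm_bezout {m A : ℤ} {z w : ℤ√m} (h : z * w = ⟨A, -1⟩) :
    z.norm * (w.im * w.im) + w.norm * (z.im * z.im) + 2 * A * (z.im * w.im) = 1 := by
  obtain ⟨hre, him⟩ := coords_of_datum h
  rw [Zsqrtd.norm_def, Zsqrtd.norm_def]
  linear_combination (-2 * z.im * w.im) * hre + (z.re * w.im + z.im * w.re - 1) * him

/-- Hence every common divisor of `N z`, `N w` and `2A` is a unit of `ℤ`. -/
theorem isUnit_of_dvd {m A : ℤ} {z w : ℤ√m} (h : z * w = ⟨A, -1⟩) {d : ℤ}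
    (h1 : d ∣ z.norm) (h2 : d ∣ w.norm) (h3 : d ∣ 2 * A) : IsUnit d := by
  apply isUnit_of_dvd_one
  rw [← norm_bezout h]
  exact dvd_add (dvd_add (dvd_mul_of_dvd_left h1 _) (dvd_mul_of_dvd_left h2 _)) (dvd_mul_of_dvd_left h3 _)

/-- The same as a gcd: `gcd(gcd(N z, N w), 2A) = 1`. -/
theorem gcd_norm_norm_two_mul_eq_one {m A : ℤ} {z w : ℤ√m} (h : z * w = ⟨A, -1⟩) :
    Int.gcd (Int.gcd z.norm w.norm : ℤ) (2 * A) = 1 := by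
  have hu : IsUnit (((Int.gcd (Int.gcd z.norm w.norm : ℤ) (2 * A) : ℕ) : ℤ)) :=
    isUnit_of_dvd h (dvd_trans (Int.gcd_dvd_left _ _) (Int.gcd_dvd_left _ _))
      (dvd_trans (Int.gcd_dvd_left _ _) (Int.gcd_dvd_right _ _)) (Int.gcd_dvd_right _ _)
  rcases Int.isUnit_iff.1 hu with h0 | h0
  · exact_mod_cast h0
  · exfalso; have : (0 : ℤ) ≤ ((Int.gcd (Int.gcd z.norm w.norm : ℤ) (2 * A) : ℕ) : ℤ) := by positivity
    linarith

/-- No prime divides `N z`, `N w` and `2A`. -/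
theorem no_prime_dvd {m A : ℤ} {z w : ℤ√m} (h : z * w = ⟨A, -1⟩) {q : ℤ} (hq : Prime q)
    (h1 : q ∣ z.norm) (h2 : q ∣ w.norm) (h3 : q ∣ 2 * A) : False :=
  hq.not_unit (isUnit_of_dvd h h1 h2 h3)

/-- **(∗) of LEMMA P in kernel form** — the hypothesis `hprim` of `LineLawProperness.no_common_prime` ∕
`gcd_hypothesis` (#B15) holds for EVERY datum: with `n := N z`, `k := N w` (so `n k = A² − m`), every common
divisor of `n`, `2A`, `k` is a unit, i.e. the form `(n, 2A, k)` attached to the principal ideal `(z) = (n, −A + √m)`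
is primitive. -/
theorem form_primitive {m A : ℤ} {z w : ℤ√m} (h : z * w = ⟨A, -1⟩) :
    ∀ d : ℤ, d ∣ z.norm → d ∣ 2 * A → d ∣ w.norm → IsUnit d :=
  fun _ h1 h3 h2 => isUnit_of_dvd h h1 h2 h3

/-- **LEMMA P (ii) for every datum.** If `T = c · N z` with `z · w = A − √m`, `N z ≠ 0` and `T ∣ A² − m`, then no
prime divides `N z`, `c` and `2A`: indeed `c · N z ∣ N z · N w` gives `c ∣ N w`. (No primitivity, squarefree or sign
hypothesis.) -/
theorem no_common_prime_of_datum {m A T c : ℤ} {z w : ℤ√m} (h : z * w = ⟨A, -1⟩) (hT : T = c * z.norm)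
    (hdiv : T ∣ A * A - m) (hn : z.norm ≠ 0) {q : ℤ} (hq : Prime q)
    (h1 : q ∣ z.norm) (h2 : q ∣ c) (h3 : q ∣ 2 * A) : False := by
  exact no_prime_dvd h hq h1 (dvd_trans h2 (weight_dvd_conorm h hT hdiv hn)) h3

/-- The same conclusion as the #B14 hypothesis `gcd(gcd(N z, c), 2A) = 1` — ready for
`LineLawIdealProduct.primIdeal_mul_of_gcd` (the factorisation `𝔞_{T∕c}(A) · 𝔞_c(A) = 𝔞_T(A)` of THEOREM E «⇒»). -/
theorem gcd_hypothesis_of_datum {m A T c : ℤ} {z w : ℤ√m} (h : z * w = ⟨A, -1⟩) (hT : T = c * z.norm)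
    (hdiv : T ∣ A * A - m) (hn : z.norm ≠ 0) :
    Int.gcd (Int.gcd z.norm c : ℤ) (2 * A) = 1 := by
  by_contra hne
  obtain ⟨p, hp, hpg⟩ := Nat.exists_prime_and_dvd hne
  have hpZ : (p : ℤ) ∣ ((Int.gcd (Int.gcd z.norm c : ℤ) (2 * A) : ℕ) : ℤ) := by exact_mod_cast hpg
  have hg1 : (((Int.gcd (Int.gcd z.norm c : ℤ) (2 * A)) : ℕ) : ℤ) ∣ ((Int.gcd z.norm c : ℕ) : ℤ) :=
    Int.gcd_dvd_left _ _
  have hpn : (p : ℤ) ∣ z.norm := dvd_trans (dvd_trans hpZ hg1) (Int.gcd_dvd_left _ _)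
  have hpc : (p : ℤ) ∣ c := dvd_trans (dvd_trans hpZ hg1) (Int.gcd_dvd_right _ _)
  have hpA : (p : ℤ) ∣ 2 * A := dvd_trans hpZ (Int.gcd_dvd_right _ _)
  exact no_common_prime_of_datum h hT hdiv hn (Nat.prime_iff_prime_int.1 hp) hpn hpc hpA

/-- **The product `N z · c` also satisfies the #B14 divisibility hypothesis**: `N z · c ∣ A² − m` is just `T ∣ A² − m`
rewritten (recorded for the assembled THEOREM E «⇒»). -/
theorem norm_mul_weight_dvd {m A T c : ℤ} {z : ℤ√m} (hT : T = c * z.norm) (hdiv : T ∣ A * A - m) :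
    z.norm * c ∣ A * A - m := by
  rw [mul_comm, ← hT]; exact hdiv

/-- **LEMMA P (i).** On a line whose weights `c i` (`i ∈ s`) admit a Bézout combination `∑ a i · c i = 1` (no common
divisor), the winding divides `A² − m`: indeed `c i · (A² − m) = c i · N z_i · N w_i = T · N w_i` for every `i`. -/
theorem winding_dvd_of_bezout {m A T : ℤ} {ι : Type*} (s : Finset ι) (c a : ι → ℤ) (z w : ι → ℤ√m)
    (h : ∀ i ∈ s, z i * w i = ⟨A, -1⟩) (hT : ∀ i ∈ s, T = c i * (z i).norm)
    (hbez : ∑ i ∈ s, a i * c i = 1) : T ∣ A * A - m := by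
  have key : ∀ i ∈ s, c i * (A * A - m) = T * (w i).norm := by
    intro i hi
    have e : (z i * w i).norm = A * A - m * (-1) * (-1) := by rw [h i hi, Zsqrtd.norm_def]
    rw [Zsqrtd.norm_mul] at e
    rw [hT i hi]; linear_combination (-(c i)) * e
  have expand : A * A - m = ∑ i ∈ s, a i * (c i * (A * A - m)) := by
    calc A * A - m = (∑ i ∈ s, a i * c i) * (A * A - m) := by rw [hbez, one_mul]
      _ = ∑ i ∈ s, a i * (c i * (A * A - m)) := by rw [Finset.sum_mul]; simp only [mul_assoc]
  rw [expand]
  exact Finset.dvd_sum fun i hi => by rw [key i hi]; exact Dvd.dvd.mul_left (dvd_mul_right T _) _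

/-- The two-weight case of LEMMA P (i) with an explicit Bézout pair `u c₁ + v c₂ = 1`. -/
theorem winding_dvd_of_coprime_pair {m A T c₁ c₂ u v : ℤ} {z₁ w₁ z₂ w₂ : ℤ√m}
    (h₁ : z₁ * w₁ = ⟨A, -1⟩) (h₂ : z₂ * w₂ = ⟨A, -1⟩) (hT₁ : T = c₁ * z₁.norm) (hT₂ : T = c₂ * z₂.norm)
    (hbez : u * c₁ + v * c₂ = 1) : T ∣ A * A - m := by
  have k₁ : c₁ * (A * A - m) = T * w₁.norm := by
    have e : (z₁ * w₁).norm = A * A - m * (-1) * (-1) := by rw [h₁, Zsqrtd.norm_def]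
    rw [Zsqrtd.norm_mul] at e; rw [hT₁]; linear_combination (-c₁) * e
  have k₂ : c₂ * (A * A - m) = T * w₂.norm := by
    have e : (z₂ * w₂).norm = A * A - m * (-1) * (-1) := by rw [h₂, Zsqrtd.norm_def]
    rw [Zsqrtd.norm_mul] at e; rw [hT₂]; linear_combination (-c₂) * e
  have : A * A - m = u * (c₁ * (A * A - m)) + v * (c₂ * (A * A - m)) := by
    linear_combination (-(A * A - m)) * hbez
  rw [this, k₁, k₂]
  exact dvd_add (Dvd.dvd.mul_left (dvd_mul_right T _) _) (Dvd.dvd.mul_left (dvd_mul_right T _) _)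

/-- Co-norm bookkeeping between two weights of one line: if `T = c · N z = c' · N z'` (`T ≠ 0`) and
`N w = c · e`, then `N w' = c' · e` — the cofactor `e = (A² − m) ∕ T` is common to all weights. -/
theorem conorm_eq_of_two_data {m A T c c' e : ℤ} {z w z' w' : ℤ√m} (h : z * w = ⟨A, -1⟩) (h' : z' * w' = ⟨A, -1⟩)
    (hT : T = c * z.norm) (hT' : T = c' * z'.norm) (hT0 : T ≠ 0) (he : w.norm = c * e) : w'.norm = c' * e := by
  have m1 : z.norm * w.norm = A * A - m := by
    have ee : (z * w).norm = A * A - m * (-1) * (-1) := by rw [h, Zsqrtd.norm_def]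
    rw [Zsqrtd.norm_mul] at ee; linear_combination ee
  have m2 : z'.norm * w'.norm = A * A - m := by
    have ee : (z' * w').norm = A * A - m * (-1) * (-1) := by rw [h', Zsqrtd.norm_def]
    rw [Zsqrtd.norm_mul] at ee; linear_combination ee
  -- `T · N w' = c' · (A² − m) = c' · N z · N w = c' · N z · c · e = T · (c' e)`
  have key : T * w'.norm = T * (c' * e) := by
    calc T * w'.norm = c' * (z'.norm * w'.norm) := by rw [hT']; ring
      _ = c' * (z.norm * w.norm) := by rw [m2, m1]
      _ = T * (c' * e) := by rw [he, hT]; ring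
  exact mul_left_cancel₀ hT0 key

/-- **LEMMA P (iii) for every datum — the weight ideal `𝔞_c(A) = (c, −A + √m)` is proper.**  Let two weights `c, c'`
lie on one line reached at `(T, A)` (`T ≠ 0`, `T ∣ A² − m`), and let `q` be a prime dividing `c` but not `c'`.  Then `q`
does not divide both `2A` and `(A² − m) ∕ c`: the form `(c, 2A, (A² − m)∕c)` is primitive at `q`.  Proof: write
`N w = c e`, so `(A² − m)∕c = N z · e`; if `q ∣ N z` then `q` divides `N z`, `N w` (via `c`) and `2A` — excluded by
`no_prime_dvd` for `(z, w)`; if `q ∣ e` then, `N w' = c' e` and `q ∣ T = c' N z'` with `q ∤ c'` giving `q ∣ N z'`,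
`q` divides `N z'`, `N w'`, `2A` — excluded for `(z', w')`. -/
theorem weightForm_primitive_at {m A T c c' k : ℤ} {z w z' w' : ℤ√m} (h : z * w = ⟨A, -1⟩)
    (h' : z' * w' = ⟨A, -1⟩) (hT : T = c * z.norm) (hT' : T = c' * z'.norm) (hT0 : T ≠ 0)
    (hdiv : T ∣ A * A - m) (hk : c * k = A * A - m) {q : ℤ} (hq : Prime q) (hqc : q ∣ c) (hqc' : ¬ q ∣ c')
    (hqA : q ∣ 2 * A) (hqk : q ∣ k) : False := by
  have hn : z.norm ≠ 0 := by intro h0; apply hT0; rw [hT, h0, mul_zero]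
  have hc0 : c ≠ 0 := by intro h0; apply hT0; rw [hT, h0, zero_mul]
  obtain ⟨e, he⟩ := weight_dvd_conorm h hT hdiv hn
  -- `k = N z · e`
  have m1 : z.norm * w.norm = A * A - m := by
    have ee : (z * w).norm = A * A - m * (-1) * (-1) := by rw [h, Zsqrtd.norm_def]
    rw [Zsqrtd.norm_mul] at ee; linear_combination ee
  have hke : k = z.norm * e := by
    apply mul_left_cancel₀ hc0
    rw [hk, ← m1, he]; ring
  rw [hke] at hqk
  rcases hq.dvd_or_dvd hqk with hqn | hqe
  · exact no_prime_dvd h hq hqn (dvd_trans hqc ⟨e, he⟩) hqA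
  · have hw' : w'.norm = c' * e := conorm_eq_of_two_data h h' hT hT' hT0 he
    have hqT : q ∣ T := by rw [hT]; exact dvd_mul_of_dvd_left hqc _
    have hqn' : q ∣ z'.norm := by
      rw [hT'] at hqT
      rcases hq.dvd_or_dvd hqT with h1 | h1
      · exact absurd h1 hqc'
      · exact h1
    exact no_prime_dvd h' hq hqn' (by rw [hw']; exact dvd_mul_of_dvd_right hqe _) hqA

/-- **LEMMA P (iii), family form.** If the weights `c i` (`i ∈ s`) of a line reached at `(T, A)` (`T ≠ 0`,
`T ∣ A² − m`) have no common divisor (`∑ a i · c i = 1`), then for every weight `c i` with `c i · k = A² − m` every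
common divisor of `c i`, `2A`, `k` is a unit: all the ideals `𝔞_{c i}(A)` are proper ideals of `ℤ√m` (primitive forms
`(c i, 2A, k)`), so THEOREM E's «one class» is a statement in the form class group of discriminant `4m`. -/
theorem weightForm_primitive_of_bezout {m A T : ℤ} {ι : Type*} (s : Finset ι) (c a : ι → ℤ) (z w : ι → ℤ√m)
    (h : ∀ i ∈ s, z i * w i = ⟨A, -1⟩) (hT : ∀ i ∈ s, T = c i * (z i).norm) (hbez : ∑ i ∈ s, a i * c i = 1)
    (hT0 : T ≠ 0) (hdiv : T ∣ A * A - m) {i : ι} (hi : i ∈ s) {k : ℤ} (hk : c i * k = A * A - m) :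
    ∀ d : ℤ, d ∣ c i → d ∣ 2 * A → d ∣ k → IsUnit d := by
  intro d hdc hdA hdk
  by_contra hnu
  -- take a prime factor `q` of the non-unit `d`
  obtain ⟨q, hqprime, hqd⟩ : ∃ q : ℤ, Prime q ∧ q ∣ d :=
    Int.exists_prime_and_dvd (fun h1 => hnu (Int.isUnit_iff_natAbs_eq.2 h1))
  -- some weight is prime to `q` (Bézout)
  have hex : ∃ j ∈ s, ¬ q ∣ c j := by
    by_contra hall
    simp only [not_exists, not_and, not_not] at hall
    have : q ∣ ∑ j ∈ s, a j * c j := Finset.dvd_sum fun j hj => dvd_mul_of_dvd_right (hall j hj) _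
    rw [hbez] at this
    exact hqprime.not_unit (isUnit_of_dvd_one this)
  obtain ⟨j, hj, hqj⟩ := hex
  exact weightForm_primitive_at (h i hi) (h j hj) (hT i hi) (hT j hj) hT0 hdiv hk hqprime
    (dvd_trans hqd hdc) hqj (dvd_trans hqd hdA) (dvd_trans hqd hdk)

/-- Worked check (LINE-LAW-THEOREMS-B.md §9 (1), `m = −5`, `A = 5`, weight `6`): `z = 1 + √−5` (norm 6) and
`w = −√−5` give `z w = 5 − √−5`, and the identity reads `6·1 + 5·1 + 10·(1·(−1)) = 1`. -/
example : (⟨1, 1⟩ : ℤ√(-5)) * ⟨0, -1⟩ = ⟨5, -1⟩ ∧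
    (⟨1, 1⟩ : ℤ√(-5)).norm * ((-1) * (-1)) + (⟨0, -1⟩ : ℤ√(-5)).norm * (1 * 1) + 2 * 5 * (1 * (-1)) = 1 := by
  refine ⟨by ext <;> simp, ?_⟩
  simp [Zsqrtd.norm_def]

end Summit.Ventures.HSemireg.LineLawPrincipalProper
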